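import Literature.AlgebraicGeometry.Villamayor2007.CharPolyGenerators
import Mathlib.RingTheory.IntegralClosure.IsIntegralClosure.Basic
import Mathlib.Algebra.Polynomial.Lifts
import HarnessLib

/-!
# Villamayor 2007, Prop. 1.23 (integrality half) and Def. 1.42 (1.42.4): `R̄_b` — indeed all of
# `k[Y_i − Y_j]` — is INTEGRAL over the computable algebra `H_{F_b}`, PROVED

O. E. Villamayor U., *Hypersurface singularities in positive characteristic*, Adv. Math. **213** (2007)
687–733 = arXiv:math/0606796 [Villamayor2007]; locators «p00NN Lnn» = chunk · line of the held arXiv text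
(`lit read paper:arxiv-math_0606796`, chunks p0008, p0010, p0014 re-read before typing). Sequel of
`CharPolyGenerators.lean` (`hSubalgebra = H_{F_b}`, `charPolyOf`, `eval_charPolyOf_self`,
`coeff_charPolyOf_mem_hSubalgebra`, `taylor_univMonic_X`, `univMonicDeltaAt_eq_coeff_taylor`). Campaign
`res-hironaka` (D-0089), ladder rung LIT-6. PROOF file: theorems only, no definitions, no named facts; nothing of
Hironaka's 2017 manuscript is referred to.

## What is proved

* **Prop. 1.23 p0010 L66–L67, L84–L96.** «`R̄_b` is the integral closure of the graded ring `H_{F_b}` in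
  `k[s_{b,1},…,s_{b,b}]` … the elements `F_b^{(e)}(Y₁)` are integral over `H_{F_b}` since they satisfy the
  characteristic polynomial (i.e., they are roots of their own characteristic polynomials).» PROVED: the
  INTEGRALITY HALF — `isIntegral_univMonicDeltaAt` (each `F_b^{(e)}(Y_j)`, `1 ≤ e ≤ b − 1`, is integral over
  `H_{F_b}`, witness `ψ_{F_b^{(e)}}`), `X_sub_X_mem_integralClosure` (each `Y_i − Y_j` is integral over `H_{F_b}`: it
  is a root of `F_b(Y_j + T) = ∏ (T + (Y_j − Y_{i'}))`, Remark 1.8, whose coefficients are the `F_b^{(e)}(Y_j)`),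
  hence `mem_integralClosure_of_mem_diffSubalgebra` (all of `k[Y_i − Y_j]`), `univElimOne_subset_integralClosure` and **`isIntegral_of_mem_univElimOne`**
  (every element of `R̄_b` is integral over `H_{F_b}`), i.e. `R̄_b ⊆` the integral closure of `H_{F_b}`. The route
  through `k[Y_i − Y_j]` replaces the printed route through Cor. 1.10 b) (not typed). NOT proved: the converse
  inclusion iii) «`R̄_b` is integrally closed in `k[s]`» (normality, (rk09)).
* **Def. 1.42 (1.42.4) p0014 L56–L64** «`ℋ_f ⊂ R̄_f` and that this ring extension is finite» — the universal
  integrality above is what makes it finite; the specialized, `W`-graded statement is NOT typed here (it needs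
  homogeneous integral equations; recorded as not done).

## References

* O. E. Villamayor U., Adv. Math. 213 (2007) 687–733 = arXiv:math/0606796: Remark 1.8, Lemma 1.19, Def. 1.21,
  Prop. 1.23, Def. 1.42. [Villamayor2007]
-/

noncomputable section

open scoped Polynomial

namespace Literature.AlgebraicGeometry.Villamayor2007

open MvPolynomial

universe u v w

/-! ## Integrality from a monic equation with coefficients in a subalgebra -/

section Generic

variable {R : Type v} [CommRing R] {B : Type u} [CommRing B] [Algebra R B]

/-- A root of a monic polynomial all of whose coefficients lie in a subalgebra `A` is integral over `A`
(«they satisfy the characteristic polynomial», p0010 L88–L89). [cite: Villamayor2007, Prop. 1.23 p0010 L84–L89] -/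
theorem isIntegral_of_monic_of_coeff_mem (A : Subalgebra R B) {p : B[X]} (hp : p.Monic)
    (hcoeff : ∀ n, p.coeff n ∈ A) {x : B} (hx : p.eval x = 0) : IsIntegral A x := by
  have hlifts : p ∈ Polynomial.lifts (algebraMap A B) := by
    rw [Polynomial.lifts_iff_coeff_lifts]
    intro n
    exact ⟨⟨p.coeff n, hcoeff n⟩, rfl⟩
  obtain ⟨q, hq, -, hqmonic⟩ := Polynomial.lifts_and_natDegree_eq_and_monic hlifts hp
  refine ⟨q, hqmonic, ?_⟩
  rw [Polynomial.eval₂_eq_eval_map, hq, hx]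

/-- Integral closures are integrally closed: a root of a monic polynomial with coefficients in
`integralClosure R B` lies in `integralClosure R B` (Mathlib `integralClosure_idem`).
[cite: Villamayor2007, Prop. 1.23 p0010 L84–L96] -/
theorem mem_integralClosure_of_monic_of_coeff_mem {p : B[X]} (hp : p.Monic)
    (hcoeff : ∀ n, p.coeff n ∈ integralClosure R B) {x : B} (hx : p.eval x = 0) :
    x ∈ integralClosure R B := by
  have h : x ∈ integralClosure (integralClosure R B) B :=
    isIntegral_of_monic_of_coeff_mem (integralClosure R B) hp hcoeff hx
  rw [integralClosure_idem, Algebra.mem_bot] at h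
  obtain ⟨c, rfl⟩ := h
  exact c.2

end Generic

/-! ## Prop. 1.23: `F_b^{(e)}(Y_j)`, then `Y_i − Y_j`, then `k[Y_i − Y_j] ⊇ R̄_b` are integral over `H_{F_b}` -/

section Prop123

variable {ι : Type u} {k : Type v} [CommRing k] [Fintype ι]

/-- **`F_b^{(e)}(Y_j)` is integral over `H_{F_b}`** [Villamayor 2007, Prop. 1.23 proof p0010 L86–L89 «the elements
`F_b^{(e)}(Y₁)` are integral over `H_{F_b}` since they satisfy the characteristic polynomial (i.e., they are roots
of their own characteristic polynomials)»]: for `1 ≤ e ≤ b − 1` the monic `ψ_{F_b^{(e)}}(V)` has its coefficients in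
`H_{F_b}` (Def. 1.21) and `ψ(F_b^{(e)}(Y_j)) = 0` (Lemma 1.19). [cite: Villamayor2007, Prop. 1.23 p0010 L86–L89] -/
theorem isIntegral_univMonicDeltaAt {e : ℕ} (he1 : 1 ≤ e) (he : e + 1 ≤ Fintype.card ι) (j : ι) :
    IsIntegral (hSubalgebra ι k) (univMonicDeltaAt ι k e j) :=
  isIntegral_of_monic_of_coeff_mem (hSubalgebra ι k) (charPolyOf_monic (univMonicDelta ι k e))
    (fun n => coeff_charPolyOf_mem_hSubalgebra he1 he n) (eval_charPolyOf_self (univMonicDelta ι k e) j)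

/-- **`Y_i − Y_j` is integral over `H_{F_b}`** (Remark 1.8 p0008 L16–L19: `Y_i − Y_j` is a root of `F_b(Y_j + T) =
∏_{i'} (T + (Y_j − Y_{i'}))`, a monic polynomial whose coefficients `F_b^{(e)}(Y_j)` are integral over `H_{F_b}`;
then use that integral closures are integrally closed). [cite: Villamayor2007, Prop. 1.23 p0010 L84–L96] -/
theorem X_sub_X_mem_integralClosure (i j : ι) :
    (X i - X j : MvPolynomial ι k) ∈ integralClosure (hSubalgebra ι k) (MvPolynomial ι k) := by
  rcases subsingleton_or_nontrivial k with hk | hk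
  · rw [Subsingleton.elim (X i - X j : MvPolynomial ι k) 0]
    exact Subalgebra.zero_mem _
  -- `P(T) = F_b(Y_j + T)`
  set P : (MvPolynomial ι k)[X] := Polynomial.taylor (X j) (univMonic ι k) with hP
  have hPmonic : P.Monic := by
    rw [hP, Polynomial.Monic, Polynomial.leadingCoeff_taylor]
    exact univMonic_monic
  have hPdeg : P.natDegree = Fintype.card ι := by
    rw [hP, Polynomial.natDegree_taylor, natDegree_univMonic]
  refine mem_integralClosure_of_monic_of_coeff_mem hPmonic (fun n => ?_) ?_
  · -- coefficients: `F_b(Y_j) = 0`, `F_b^{(e)}(Y_j)` (integral), leading `1`, then `0`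
    rcases Nat.eq_zero_or_pos n with h0 | h0
    · subst h0
      rw [hP, Polynomial.taylor_coeff_zero, univMonic, Polynomial.eval_prod,
        Finset.prod_eq_zero (Finset.mem_univ j) (by simp)]
      exact Subalgebra.zero_mem _
    rcases Nat.lt_or_ge (n + 1) (Fintype.card ι + 1) with hlt | hge
    · rw [hP, ← univMonicDeltaAt_eq_coeff_taylor]
      exact isIntegral_univMonicDeltaAt h0 (by omega) j
    rcases Nat.eq_or_lt_of_le hge with heq | hgt
    · have hn : n = Fintype.card ι := by omega
      subst hn
      rw [← hPdeg, hPmonic.coeff_natDegree]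
      exact Subalgebra.one_mem _
    · rw [Polynomial.coeff_eq_zero_of_natDegree_lt (by rw [hPdeg]; omega)]
      exact Subalgebra.zero_mem _
  · -- root: the factor `i' = i` of `∏ (T + (Y_j − Y_{i'}))` vanishes at `T = Y_i − Y_j`
    rw [hP, taylor_univMonic_X, Polynomial.eval_prod]
    exact Finset.prod_eq_zero (Finset.mem_univ i) (by simp)

/-- **`k[Y_i − Y_j]` is integral over `H_{F_b}`** (every difference is, and integral elements form a subalgebra).
[cite: Villamayor2007, Prop. 1.23 p0010 L84–L96] -/
theorem mem_integralClosure_of_mem_diffSubalgebra {p : MvPolynomial ι k} (hp : p ∈ diffSubalgebra ι k) :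
    p ∈ integralClosure (hSubalgebra ι k) (MvPolynomial ι k) := by
  induction hp using Algebra.adjoin_induction with
  | mem x hx =>
    obtain ⟨⟨i, j⟩, rfl⟩ := hx
    exact X_sub_X_mem_integralClosure i j
  | algebraMap r =>
    have h : algebraMap k (MvPolynomial ι k) r =
        algebraMap (hSubalgebra ι k) (MvPolynomial ι k) ⟨algebraMap k (MvPolynomial ι k) r,
          (hSubalgebra ι k).algebraMap_mem r⟩ := rfl
    rw [h]
    exact Subalgebra.algebraMap_mem _ _
  | add x y _ _ hx hy => exact Subalgebra.add_mem _ hx hy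
  | mul x y _ _ hx hy => exact Subalgebra.mul_mem _ hx hy

/-- **Prop. 1.23, integrality half: `R̄_b` is integral over `H_{F_b}`** [Villamayor 2007, Prop. 1.23 p0010 L66–L67
«`R̄_b` is the integral closure of the graded ring `H_{F_b}` in `k[s_{b,1},…,s_{b,b}]`»]: every element of
`R̄_b = k[Y_i − Y_j]^{𝕊_b}` is integral over `H_{F_b}` (the inclusion `R̄_b ⊆` integral closure; the converse
inclusion, normality of `R̄_b`, is not proved here). [cite: Villamayor2007, Prop. 1.23 p0010 L66–L96] -/
theorem isIntegral_of_mem_univElimOne {p : MvPolynomial ι k} (hp : p ∈ univElimOne ι k) :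
    IsIntegral (hSubalgebra ι k) p :=
  mem_integralClosure_of_mem_diffSubalgebra hp.1

/-- The same for every universal elimination algebra `R̄_{c₁,…,c_r} ⊆ k[Y_i − Y_j]` of a block structure on the
`b` roots (1.24–1.26: they are finite over `R̄_b`). [cite: Villamayor2007, Prop. 1.23 p0010 L66–L96] -/
theorem isIntegral_of_mem_univElim {β : Type w} {blk : ι → β} {p : MvPolynomial ι k}
    (hp : p ∈ univElim ι k blk) : IsIntegral (hSubalgebra ι k) p :=
  mem_integralClosure_of_mem_diffSubalgebra hp.1

/-- `R̄_b ≤` the integral closure of `H_{F_b}` in `k[Y]`, as subalgebras over `H_{F_b}` restricted to sets.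
[cite: Villamayor2007, Prop. 1.23 p0010 L66–L96] -/
theorem univElimOne_subset_integralClosure :
    (univElimOne ι k : Set (MvPolynomial ι k)) ⊆ integralClosure (hSubalgebra ι k) (MvPolynomial ι k) :=
  fun _ hp => mem_integralClosure_of_mem_diffSubalgebra hp.1

end Prop123

end Literature.AlgebraicGeometry.Villamayor2007

end
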